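import Summits.Ventures.PercRepro.Night2HitCap

/-!
# night-2: THE HIGH-LEVEL THEOREM — the fair share from the hitting targets above the longest line (gen 39)

Let `(B, z)` be a lossy basis pair of the non-fat cell `(2, 1)`, `W = G ∖ Q` with `N = |W|`, and suppose every line
`cl {x, y}` (`x ≠ y ∈ G`) carries at most `L ≥ 1` points of `W`.  The targets `Q ∪ Y` with `|Y| ≥ L + 3` and `Y` hitting
(`Y ⊄ cl (Q.erase w)` for every active face `w`) are
* unloaded (`dload_eq_zero_of_level_of_lines_le`: a load needs `≥ |Y| − 2 ≥ L + 1` collinear points of `Y`),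
* of capacity `vCap ≥ 11/18` (`vCap_ge_of_hitting`),
* of face sum `≤ C(|Y| + 5, 4) / 3` (`faceSum_le_third_mul_choose`),
and at level `i` they number at least `C(N, i) − 5 · C(N − 2, i)` (`card_filter_hitting_ge`).  Regrouped by level:
**`basis_pair_fair_of_high_levels`** — the pair is fair as soon as
`1 ≤ highIncome N L := Σ_{i = L+3}^{N} (11/18) · (C(N, i) − 5 C(N − 2, i))⁺ · 3 / C(i + 5, 4)`.
Numerically (mining/night-2/g39/high2.py) `highIncome N L ≥ 1` for `N ≥ L + 7` when `L ≥ 7`, and for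
`(L, N) = (2, 11), (3, 11), (4, 12), (5, 12), (6, 13)`.  Paper: proofs/NIGHT-2-g39.md §3.
-/

namespace PercRepro.Shadow

open PercRepro.ThmH PercRepro.PerFlat

variable {α : Type*} [DecidableEq α] {M : Matroid α} [M.Finite] {G : Finset α}

/-- The high-level income: `Σ_{i = L+3}^{N} (11/18) · (C(N, i) − 5 · C(N − 2, i))⁺ · 3 / C(i + 5, 4)`. -/
noncomputable def highIncome (N L : ℕ) : ℚ :=
  ∑ i ∈ Finset.range (N + 1), if L + 3 ≤ i then
    11 / 18 * max 0 (((N.choose i : ℕ) : ℚ) - 5 * (((N - 2).choose i : ℕ) : ℚ)) * 3 /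
      (((i + 5).choose 4 : ℕ) : ℚ)
  else 0

/-- Every summand of `highIncome` is nonnegative. -/
theorem highIncome_term_nonneg (N L j : ℕ) :
    (0 : ℚ) ≤ (if L + 3 ≤ j then
      11 / 18 * max 0 (((N.choose j : ℕ) : ℚ) - 5 * (((N - 2).choose j : ℕ) : ℚ)) * 3 /
        (((j + 5).choose 4 : ℕ) : ℚ) else 0) := by
  split_ifs
  · positivity
  · exact le_rfl

/-- `highIncome` is nonnegative. -/
theorem highIncome_nonneg (N L : ℕ) : 0 ≤ highIncome N L :=
  Finset.sum_nonneg (fun j _ => highIncome_term_nonneg N L j)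

/-- **A single level bounds the high-level income from below.** -/
theorem term_le_highIncome {N L i : ℕ} (hi : L + 3 ≤ i) (hiN : i ≤ N) :
    11 / 18 * max 0 (((N.choose i : ℕ) : ℚ) - 5 * (((N - 2).choose i : ℕ) : ℚ)) * 3 /
      (((i + 5).choose 4 : ℕ) : ℚ) ≤ highIncome N L := by
  unfold highIncome
  have h := Finset.single_le_sum (fun j _ => highIncome_term_nonneg N L j)
    (Finset.mem_range.2 (Nat.lt_succ_of_le hiN))
  rw [if_pos hi] at h
  exact h

/-- **Two levels bound the high-level income from below.** -/
theorem two_terms_le_highIncome {N L i j : ℕ} (hi : L + 3 ≤ i) (hiN : i ≤ N) (hij : i < j) (hjN : j ≤ N) :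
    11 / 18 * max 0 (((N.choose i : ℕ) : ℚ) - 5 * (((N - 2).choose i : ℕ) : ℚ)) * 3 /
        (((i + 5).choose 4 : ℕ) : ℚ) +
      11 / 18 * max 0 (((N.choose j : ℕ) : ℚ) - 5 * (((N - 2).choose j : ℕ) : ℚ)) * 3 /
        (((j + 5).choose 4 : ℕ) : ℚ) ≤ highIncome N L := by
  unfold highIncome
  have hsub : ({i, j} : Finset ℕ) ⊆ Finset.range (N + 1) := by
    intro x hx
    rw [Finset.mem_insert, Finset.mem_singleton] at hx
    rcases hx with rfl | rfl
    · exact Finset.mem_range.2 (Nat.lt_succ_of_le hiN)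
    · exact Finset.mem_range.2 (Nat.lt_succ_of_le hjN)
  have h := Finset.sum_le_sum_of_subset_of_nonneg hsub (fun x _ _ => highIncome_term_nonneg N L x)
  rw [Finset.sum_pair (Nat.ne_of_lt hij), if_pos hi, if_pos (by omega)] at h
  exact h

/-- **Lines through two points of `W` control every line**: if every line through two points of `W` carries at most
`L ≥ 1` points of `W`, so does every line `cl {x, y}` (`x ≠ y ∈ G`): two points of `W` on it span it. -/
theorem lines_le_of_pairs_le (hs : ∀ e ∈ gr M, ∀ f ∈ gr M, e ≠ f → rkN M {e, f} = 2) (hG : G ∈ flatsQ M (5 + 1))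
    {Q : Finset α} {L : ℕ} (hL1 : 1 ≤ L)
    (hL : ∀ x ∈ G \ Q, ∀ y ∈ G \ Q, x ≠ y → ((G \ Q) ∩ clF M {x, y}).card ≤ L) :
    ∀ x ∈ G, ∀ y ∈ G, x ≠ y → ((G \ Q) ∩ clF M {x, y}).card ≤ L := by
  have hGg : G ⊆ gr M := (mem_flatsQ.1 hG).1
  intro x _ y _ _
  rcases Nat.lt_or_ge ((G \ Q) ∩ clF M {x, y}).card 2 with hlt | hge
  · omega
  · obtain ⟨w₁, hw₁, w₂, hw₂, hne⟩ := Finset.one_lt_card.1 hge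
    have hℓg : clF M {x, y} ⊆ gr M := fun e he => mem_gr_of_mem_clF he
    have hℓ2 : rkN M (clF M {x, y}) ≤ 2 := by
      refine le_trans (rkN_le_of_subset_clF' (Finset.Subset.refl _)) ?_
      exact le_trans (rkN_le_card _) Finset.card_le_two
    have hpair : ({w₁, w₂} : Finset α) ⊆ gr M := by
      intro e he
      rw [Finset.mem_insert, Finset.mem_singleton] at he
      rcases he with rfl | rfl
      · exact hGg (Finset.mem_sdiff.1 (Finset.mem_inter.1 hw₁).1).1
      · exact hGg (Finset.mem_sdiff.1 (Finset.mem_inter.1 hw₂).1).1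
    have hsub : clF M {x, y} ⊆ clF M {w₁, w₂} :=
      subset_clF_of_rkN_le_two_of_two_mem hs hℓg hℓ2 (Finset.mem_inter.1 hw₁).2 (Finset.mem_inter.1 hw₂).2 hne
        (subset_clF_of_subset_gr hpair (Finset.mem_insert_self _ _))
        (subset_clF_of_subset_gr hpair (Finset.mem_insert_of_mem (Finset.mem_singleton_self _)))
    have h1 := Finset.card_le_card (Finset.inter_subset_inter_left hsub :
      (G \ Q) ∩ clF M {x, y} ⊆ (G \ Q) ∩ clF M {w₁, w₂})
    exact le_trans h1 (hL w₁ (Finset.mem_inter.1 hw₁).1 w₂ (Finset.mem_inter.1 hw₂).1 hne)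

/-- **The hitting targets above the longest line are targets, and their income is at least `highIncome N L`.** -/
theorem high_targets_subset_and_income (hG : G ∈ flatsQ M (5 + 1)) (hd : (gr M \ G).card = 2)
    (hk : kColoops M G = 1) (hs : ∀ e ∈ gr M, ∀ f ∈ gr M, e ≠ f → rkN M {e, f} = 2)
    (hl : ∀ e ∈ gr M, M.Indep {e}) (hnf : fatClosures M 5 G 2 = ∅) {B : Finset α}
    (hB : B ∈ thinMembers M 5 G) (hnP : ¬ bigP M G B) {z : α} (hz : z ∈ G \ clF M B)
    (hl0 : loss M 5 G B z ≠ 0) {L : ℕ} (hL1 : 1 ≤ L)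
    (hL : ∀ x ∈ G \ insert z B, ∀ y ∈ G \ insert z B, x ≠ y →
      ((G \ insert z B) ∩ clF M {x, y}).card ≤ L) :
    (((G \ insert z B).powerset.filter (fun Y => L + 3 ≤ Y.card ∧
        ∀ w ∈ (insert z B \ coloops M G).filter (fun w => faceOk M G (insert z B) w),
          ¬ Y ⊆ clF M ((insert z B).erase w))).image (fun Y => insert z B ∪ Y)) ⊆ tgtSets M 5 G B z ∧
      highIncome (G \ insert z B).card L ≤
        ∑ T ∈ ((G \ insert z B).powerset.filter (fun Y => L + 3 ≤ Y.card ∧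
          ∀ w ∈ (insert z B \ coloops M G).filter (fun w => faceOk M G (insert z B) w),
            ¬ Y ⊆ clF M ((insert z B).erase w))).image (fun Y => insert z B ∪ Y),
          vCap M G T / faceSum M G T := by
  have hfat : (fatClosures M 5 G 2).card ≤ 1 := by
    rw [hnf, Finset.card_empty]
    exact zero_le_one
  have hQG : insert z B ⊆ G :=
    Finset.insert_subset (Finset.mem_sdiff.1 hz).1 (subset_G_of_mem_thinMembers hB)
  set fam : Finset (Finset α) := (G \ insert z B).powerset.filter (fun Y => L + 3 ≤ Y.card ∧
    ∀ w ∈ (insert z B \ coloops M G).filter (fun w => faceOk M G (insert z B) w),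
      ¬ Y ⊆ clF M ((insert z B).erase w)) with hfam
  set 𝒯 : Finset (Finset α) := fam.image (fun Y => insert z B ∪ Y) with h𝒯
  have hmem : ∀ Y ∈ fam, Y ⊆ G \ insert z B ∧ L + 3 ≤ Y.card ∧
      ∀ w ∈ (insert z B \ coloops M G).filter (fun w => faceOk M G (insert z B) w),
        ¬ Y ⊆ clF M ((insert z B).erase w) := by
    intro Y hY
    rw [hfam, Finset.mem_filter, Finset.mem_powerset] at hY
    exact ⟨hY.1, hY.2.1, hY.2.2⟩
  -- the targets
  have h𝒯sub : 𝒯 ⊆ tgtSets M 5 G B z := by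
    intro T hT
    rw [h𝒯, Finset.mem_image] at hT
    obtain ⟨Y, hY, rfl⟩ := hT
    obtain ⟨hYW, hYc, -⟩ := hmem Y hY
    rw [tgtSets_eq_image hG (mem_thinMembers.1 hB).1 hz, Finset.mem_image]
    refine ⟨Y, Finset.mem_filter.2 ⟨Finset.mem_powerset.2 hYW, ?_⟩, rfl⟩
    rw [← Finset.card_pos]
    omega
  -- injectivity: `Y` is recovered as `T ∩ W`
  have hinj : Set.InjOn (fun Y => insert z B ∪ Y) (fam : Set (Finset α)) := by
    intro Y₁ hY₁ Y₂ hY₂ heq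
    rw [Finset.mem_coe] at hY₁ hY₂
    have key : ∀ Y ∈ fam, (insert z B ∪ Y) ∩ (G \ insert z B) = Y := by
      intro Y hY
      ext x
      rw [Finset.mem_inter, Finset.mem_union]
      constructor
      · rintro ⟨hx | hx, hxW⟩
        · exact absurd hx (Finset.mem_sdiff.1 hxW).2
        · exact hx
      · intro hx
        exact ⟨Or.inr hx, (hmem Y hY).1 hx⟩
    have h1 := key Y₁ hY₁
    have h2 := key Y₂ hY₂
    simp only at heq
    rw [← h1, ← h2, heq]
  -- the per-target bound
  have hterm : ∀ Y ∈ fam, 11 / 18 * 3 / (((Y.card + 5).choose 4 : ℕ) : ℚ) ≤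
      vCap M G (insert z B ∪ Y) / faceSum M G (insert z B ∪ Y) := by
    intro Y hY
    obtain ⟨hYW, hYc, hYhit⟩ := hmem Y hY
    have hT : insert z B ∪ Y ∈ tgtSets M 5 G B z := h𝒯sub (Finset.mem_image.2 ⟨Y, hY, rfl⟩)
    have hTG : insert z B ∪ Y ⊆ G := Finset.union_subset hQG (hYW.trans Finset.sdiff_subset)
    have hne : Y.Nonempty := by
      rw [← Finset.card_pos]
      omega
    have hdl := dload_eq_zero_of_level_of_lines_le hG hd hk hs hl hfat hB hnP hz hL1
      (lines_le_of_pairs_le hs hG hL1 hL) hYW hYc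
    have hv := vCap_ge_of_hitting hG hd hk hB hnP hz hYW hne hdl hYhit
    have hpos := faceSum_pos_of_mem_tgtSets hG hd hk hB hnP hz hl0 hT
    have hfs := faceSum_le_third_mul_choose hG hd hk hnf hTG
    rw [card_union_sdiff_coloops_eq hG hd hk hB hnP hz hYW, add_comm] at hfs
    have hC : (0 : ℚ) < (((Y.card + 5).choose 4 : ℕ) : ℚ) := by
      exact_mod_cast Nat.choose_pos (by omega)
    rw [div_le_div_iff₀ hC hpos]
    nlinarith
  -- the sum over the targets
  have hsum𝒯 : ∑ Y ∈ fam, 11 / 18 * 3 / (((Y.card + 5).choose 4 : ℕ) : ℚ) ≤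
      ∑ T ∈ 𝒯, vCap M G T / faceSum M G T := by
    rw [h𝒯, Finset.sum_image hinj]
    exact Finset.sum_le_sum hterm
  -- regroup by level
  have hmaps : ∀ Y ∈ fam, Y.card ∈ Finset.range ((G \ insert z B).card + 1) := fun Y hY =>
    Finset.mem_range.2 (Nat.lt_succ_of_le (Finset.card_le_card (hmem Y hY).1))
  have hfiber := Finset.sum_fiberwise_of_maps_to hmaps
    (fun Y => 11 / 18 * 3 / (((Y.card + 5).choose 4 : ℕ) : ℚ))
  rw [← hfiber] at hsum𝒯
  refine ⟨h𝒯sub, le_trans ?_ hsum𝒯⟩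
  unfold highIncome
  apply Finset.sum_le_sum
  intro i _
  have hfib : ∑ Y ∈ fam.filter (fun Y => Y.card = i), 11 / 18 * 3 / (((Y.card + 5).choose 4 : ℕ) : ℚ) =
      ((fam.filter (fun Y => Y.card = i)).card : ℚ) * (11 / 18 * 3 / (((i + 5).choose 4 : ℕ) : ℚ)) := by
    rw [Finset.sum_congr rfl (fun Y hY => by rw [(Finset.mem_filter.1 hY).2])]
    rw [Finset.sum_const, nsmul_eq_mul]
  rw [hfib]
  split_ifs with hLi
  · have hsub : ((G \ insert z B).powersetCard i).filter (fun Y =>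
        ∀ w ∈ (insert z B \ coloops M G).filter (fun w => faceOk M G (insert z B) w),
          ¬ Y ⊆ clF M ((insert z B).erase w)) ⊆ fam.filter (fun Y => Y.card = i) := by
      intro Y hY
      rw [Finset.mem_filter, Finset.mem_powersetCard] at hY
      obtain ⟨⟨hYW, hYi⟩, hhit⟩ := hY
      rw [Finset.mem_filter, hfam, Finset.mem_filter, Finset.mem_powerset]
      exact ⟨⟨hYW, by omega, hhit⟩, hYi⟩
    have hcount := card_filter_hitting_ge hG hd hk hnf hB hnP hz i
    have hcard : ((((G \ insert z B).powersetCard i).filter (fun Y =>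
        ∀ w ∈ (insert z B \ coloops M G).filter (fun w => faceOk M G (insert z B) w),
          ¬ Y ⊆ clF M ((insert z B).erase w))).card : ℚ) ≤
        ((fam.filter (fun Y => Y.card = i)).card : ℚ) := by
      exact_mod_cast Finset.card_le_card hsub
    have hC : (0 : ℚ) ≤ 11 / 18 * 3 / (((i + 5).choose 4 : ℕ) : ℚ) := by positivity
    have hmax : max 0 ((((G \ insert z B).card.choose i : ℕ) : ℚ) -
        5 * ((((G \ insert z B).card - 2).choose i : ℕ) : ℚ)) ≤
        ((fam.filter (fun Y => Y.card = i)).card : ℚ) :=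
      max_le (by positivity) (le_trans hcount hcard)
    calc 11 / 18 * max 0 ((((G \ insert z B).card.choose i : ℕ) : ℚ) -
          5 * ((((G \ insert z B).card - 2).choose i : ℕ) : ℚ)) * 3 / (((i + 5).choose 4 : ℕ) : ℚ)
        = max 0 ((((G \ insert z B).card.choose i : ℕ) : ℚ) -
          5 * ((((G \ insert z B).card - 2).choose i : ℕ) : ℚ)) *
            (11 / 18 * 3 / (((i + 5).choose 4 : ℕ) : ℚ)) := by ring
      _ ≤ ((fam.filter (fun Y => Y.card = i)).card : ℚ) * (11 / 18 * 3 / (((i + 5).choose 4 : ℕ) : ℚ)) :=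
          mul_le_mul_of_nonneg_right hmax hC
  · positivity

/-- **THE HIGH-LEVEL THEOREM**: a lossy basis pair of the non-fat cell `(2, 1)` whose `W` has at most `L ≥ 1` points on
every line is fair as soon as `1 ≤ highIncome |W| L`. -/
theorem basis_pair_fair_of_high_levels (hG : G ∈ flatsQ M (5 + 1)) (hd : (gr M \ G).card = 2)
    (hk : kColoops M G = 1) (hs : ∀ e ∈ gr M, ∀ f ∈ gr M, e ≠ f → rkN M {e, f} = 2)
    (hl : ∀ e ∈ gr M, M.Indep {e}) (hnf : fatClosures M 5 G 2 = ∅) {B : Finset α}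
    (hB : B ∈ thinMembers M 5 G) (hnP : ¬ bigP M G B) {z : α} (hz : z ∈ G \ clF M B)
    (hl0 : loss M 5 G B z ≠ 0) {L : ℕ} (hL1 : 1 ≤ L)
    (hL : ∀ x ∈ G \ insert z B, ∀ y ∈ G \ insert z B, x ≠ y →
      ((G \ insert z B) ∩ clF M {x, y}).card ≤ L)
    (hsum : 1 ≤ highIncome (G \ insert z B).card L) :
    loss M 5 G B z ≤ rhoL M 5 G B z * lossIncomeH M 5 G (bigP M G) (dshGT2 M 5 G) B z := by
  have hfat : (fatClosures M 5 G 2).card ≤ 1 := by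
    rw [hnf, Finset.card_empty]
    exact zero_le_one
  obtain ⟨hsub, hinc⟩ := high_targets_subset_and_income hG hd hk hs hl hnf hB hnP hz hl0 hL1 hL
  exact basis_pair_fair_of_vCap_face_sum_subfamily hG hd hk hs hl hfat hB hnP hz hl0 hsub (hsum.trans hinc)

end PercRepro.Shadow
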